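import Literature.NumberTheory.DiophantineGeometry.AVIsogenyTateHomPoincareProofs
import Literature.AlgebraicGeometry.Motives.AbelianVarietyDegreeGrowth
import HarnessLib

/-!
# `Hom(A, B)` finitely generated (Mumford §19, Theorem 3): Step I from a degree *bound*

Fifth part of the proof files for the named fact
`Literature.AlgebraicGeometry.Motives.AbelianVariety.module_finite_hom` of `AVIsogenyTate`
(`Hom(A, B)` is finitely generated; Mumford, *Abelian Varieties*, §19, Theorem 3; Milne 1986,
Theorem 12.5), after `AVIsogenyTateHomProofs`, `…StepIIProofs`, `…StepIProofs` and
`…PoincareProofs`.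

Step I of the printed proof (Mumford §19, proof of Thm. 3, first step; Milne 1986, Lemma 12.7,
statement `(*)`: for `X` simple and `M ≤ End(X)` finitely generated, `ℚM ∩ End(X)` is finitely
generated) is printed with the degree theorem (Mumford §19, Thm. 2; Milne 1986, Prop. 12.4: `deg`
is a homogeneous polynomial function of degree `2g` on `End⁰(X)`), and `…StepIProofs` proves the
deduction in exactly that form. The discreteness argument, however, consumes much less than
Thm. 2, namely only

* `deg φ ≥ 1` for `φ ≠ 0` (every non-zero endomorphism of the simple `X` is an isogeny);
* the homogeneity `deg (n φ) = |n|^{2g} deg φ` — which is `deg [n]_X = n^{2g}` (Mumford §6,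
  App. 3, Prop. p. 64; in the tree the named fact `kerRank_zsmul_id X`, a consequence of the
  theorem of the cube) and the multiplicativity of degrees (`IsIsogeny.kerRank_comp`);
* an **upper bound** `deg (∑ nᵢ eᵢ) ≤ C (∑ |nᵢ|)^{2g}` on the integer combinations of every finite
  family `e` of endomorphisms (which follows from the quadraticity of `φ ↦ φ^* D` in the divisor
  class group, Mumford §6 Cor. 2 of the theorem of the cube, without intersection theory):

if `m φ = ∑ nᵢ eᵢ ∈ M` with `φ ≠ 0` then `|m|^{2g} ≤ |m|^{2g} deg φ = deg (∑ nᵢ eᵢ) ≤ C (∑ |nᵢ|)^{2g}`,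
so the rational coordinates `nᵢ / m` of the points of `ℚM ∩ End(X)` stay outside a fixed ball
around `0`, and a subgroup of `ℚ^r` with this property is discrete in `ℝ^r`, hence finitely
generated. This file proves the deduction in this weaker form and re-assembles Theorem 3 on it:

* `fg_of_le_norm_coords` — the discreteness lemma: a subgroup `S` of the saturation of a free
  finitely generated `M ≤ H` whose non-zero elements have coordinates of norm `≥ ε > 0` is
  finitely generated;
* `exists_fg_of_norm_bound` — Step I for an abstract group `H` with a function `deg : H → ℤ`,
  `≥ 1` off `0`, homogeneous of degree `d ≥ 1` along every `ℤφ`, and bounded by `C_e (∑ |nᵢ|)^d` on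
  the integer combinations of every finite family `e`;
* `AbelianVariety.exists_fg_saturation_end_of_degBound` — Step I for `End(X)` when every non-zero
  endomorphism of `X` is an isogeny (`dim X > 0`), from the named facts `isIsogeny_zsmul_id X`,
  `kerRank_zsmul_id X` and the degree bound;
* `AbelianVariety.exists_fg_saturation_hom_of_poincare_of_stepI` — the reduction of Step I for all
  `Hom(X, Y)` to Step I for `End(X)`, `X` simple of positive dimension, taken as an abstract
  hypothesis (the induction of `exists_fg_saturation_hom_of_poincare`, verbatim);
* `AbelianVariety.module_finite_hom_of_poincare_of_stepI`,
  `AbelianVariety.module_finite_hom_of_poincare_of_degBound`,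
  `AbelianVariety.module_finite_hom_of_mumford19_of_degBound` — Theorem 3 from Poincaré
  reducibility, "non-zero homomorphisms between simple abelian varieties are isogenies", the
  degree bound for simple `X`, and the named facts `isIsogeny_zsmul_id`, `kerRank_zsmul_id`,
  `natCard_torsionPoints_of_isAlgClosed` (all three consequences of the theorem of the cube in the
  tree).

## References

* [MumfordAV1970] D. Mumford, *Abelian Varieties*, §19, Thm. 3 and its proof (pp. 176–178 of the
  2nd ed.), Thm. 2 (p. 174), §6 App. 3 (p. 64). Not held; architecture as in Milne 1986.
* [Milne1986AbelianVarieties] J. S. Milne, *Abelian Varieties*, in Cornell–Silverman (eds.),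
  *Arithmetic Geometry*, Springer 1986, §12, Lemma 12.7 with `(*)` and Thm. 12.5 (held:
  `book:cornellnd-arithmetic-geometry`, PDF p. 191).

## Design

No definitions, no named facts. The degree of an endomorphism is written inline,
`if IsIsogeny φ then Hom.kerRank φ else 0`, as in `…StepIProofs`.
-/

universe u

open CategoryTheory CategoryTheory.Limits AlgebraicGeometry

noncomputable section

namespace Literature.NumberTheory.DiophantineGeometry

/-! ### The discreteness lemma with a norm bound -/

section Norm

variable {H : Type*} [AddCommGroup H]

/-- **Discreteness from separated coordinates.** Let `M ≤ H` be free with a finite basis `b`, `H`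
torsion-free, and `S ≤ H` a subgroup every element `x` of which has a non-zero multiple `m x ∈ M`.
If for some `ε > 0` the rational coordinates `(b.repr (m x))ᵢ / m` of every non-zero `x ∈ S` have
sup-norm `≥ ε`, then `S` is finitely generated: `x ↦ (b.repr (m x))ᵢ / m` is a well-defined
injective additive map `S → ℝ^ι` whose image meets the `ε`-ball only in `0`, so the image is a
discrete subgroup of a finite-dimensional real vector space (Mathlib
`instModuleFinite_of_discrete_submodule`). [folklore] -/
theorem fg_of_le_norm_coords [NoZeroSMulDivisors ℤ H] {ι : Type*} [Fintype ι]
    (M S : Submodule ℤ H) (b : Module.Basis ι ℤ M) (hS : ∀ x ∈ S, ∃ n : ℤ, n ≠ 0 ∧ n • x ∈ M)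
    {ε : ℝ} (hε : 0 < ε)
    (hsep : ∀ x ∈ S, x ≠ 0 → ∀ (m : ℤ) (y : M), m ≠ 0 → m • x = y →
      ε ≤ ‖fun i => (b.repr y i : ℝ) / m‖) :
    S.FG := by
  -- every element of `S` has a non-zero multiple in `M`; choose one
  have key : ∀ x : S, ∃ p : ℤ × M, p.1 ≠ 0 ∧ p.1 • (x : H) = p.2 := fun x => by
    obtain ⟨n, hn, h⟩ := hS x x.2
    exact ⟨⟨n, ⟨n • (x : H), h⟩⟩, hn, rfl⟩
  choose p hp0 hp using key
  -- the coordinate map `q : S → ℝ^ι`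
  let q : S → (ι → ℝ) := fun x i => (b.repr (p x).2 i : ℝ) / (p x).1
  have hq : ∀ (x : S) (m : ℤ) (y : M), m ≠ 0 → m • (x : H) = y →
      q x = fun i => (b.repr y i : ℝ) / m := fun x m y hm hy => by
    funext i
    have h := repr_mul_eq_of_smul_eq b (hp x) hy i
    have h' : ((m * b.repr (p x).2 i : ℤ) : ℝ) = ((p x).1 * b.repr y i : ℤ) := congrArg _ h
    push_cast at h'
    rw [div_eq_div_iff (Int.cast_ne_zero.2 (hp0 x)) (Int.cast_ne_zero.2 hm)]
    linarith [h']
  have hq_add : ∀ x x' : S, q (x + x') = q x + q x' := fun x x' => by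
    have hm : (p x).1 * (p x').1 ≠ 0 := mul_ne_zero (hp0 x) (hp0 x')
    have hsum : ((p x).1 * (p x').1) • ((x + x' : S) : H) =
        (((p x').1 • (p x).2 + (p x).1 • (p x').2 : M) : H) := by
      rw [Submodule.coe_add, Submodule.coe_add, Submodule.coe_smul, Submodule.coe_smul, ← hp x,
        ← hp x', smul_add, smul_smul, smul_smul, mul_comm (p x).1 (p x').1]
    rw [hq (x + x') _ _ hm hsum]
    funext i
    have h1 : ((p x).1 : ℝ) ≠ 0 := Int.cast_ne_zero.2 (hp0 x)
    have h2 : ((p x').1 : ℝ) ≠ 0 := Int.cast_ne_zero.2 (hp0 x')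
    simp only [q, Pi.add_apply, map_add, map_zsmul, Finsupp.coe_add, Finsupp.coe_smul,
      Pi.smul_apply, smul_eq_mul, Int.cast_mul, Int.cast_add]
    field_simp
  let qHom : S →ₗ[ℤ] (ι → ℝ) := (AddMonoidHom.mk' q hq_add).toIntLinearMap
  have hqHom : ∀ x : S, qHom x = q x := fun _ => rfl
  -- `q` is injective (`H` is torsion-free)
  have hq_inj : Function.Injective qHom := by
    rw [injective_iff_map_eq_zero]
    intro x hx
    rw [hqHom] at hx
    have hrepr : b.repr (p x).2 = 0 := by
      ext i
      have := congrFun hx i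
      simp only [q, Pi.zero_apply, div_eq_zero_iff, Int.cast_eq_zero] at this
      exact this.resolve_right (hp0 x)
    have h2 : (p x).2 = 0 := b.repr.injective (by rw [hrepr, map_zero])
    have h3 : (p x).1 • (x : H) = 0 := by rw [hp x, h2, Submodule.coe_zero]
    exact Subtype.ext ((smul_eq_zero.1 h3).resolve_left (hp0 x))
  -- the image is a discrete subgroup of `ℝ^ι`
  let L : Submodule ℤ (ι → ℝ) := LinearMap.range qHom
  haveI : DiscreteTopology L := by
    refine discreteTopology_of_isOpen_singleton_zero ?_
    have hU : IsOpen ((Subtype.val : L → ι → ℝ) ⁻¹' Metric.ball 0 ε) :=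
      Metric.isOpen_ball.preimage continuous_subtype_val
    convert hU using 1
    ext ⟨z, hz⟩
    simp only [Set.mem_singleton_iff, Set.mem_preimage, Metric.mem_ball, dist_zero_right]
    constructor
    · intro h
      rw [Subtype.ext_iff] at h
      change z = 0 at h
      rw [h, norm_zero]
      exact hε
    · intro h
      obtain ⟨x, rfl⟩ := LinearMap.mem_range.1 hz
      by_contra hne
      have hx0 : (x : H) ≠ 0 := by
        intro h'
        apply hne
        have hx : x = 0 := Subtype.ext h'
        subst hx
        exact Subtype.ext (map_zero qHom)
      have h1 : ε ≤ ‖qHom x‖ := by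
        rw [hqHom, hq x _ _ (hp0 x) (hp x)]
        exact hsep x x.2 hx0 _ _ (hp0 x) (hp x)
      exact absurd h (not_lt.2 h1)
  haveI : Module.Finite ℤ L := instModuleFinite_of_discrete_submodule L
  have e : S ≃ₗ[ℤ] L := LinearEquiv.ofInjective qHom hq_inj
  exact Module.Finite.iff_fg.1 (Module.Finite.equiv e.symm)

/-- A function `deg : H → ℤ` which is `≥ 1` off `0` and homogeneous of a degree `d ≥ 1` along every
`ℤφ` (`deg (n φ) = |n|^d deg φ`) forces `H` to be torsion-free: `n φ = 0` with `n ≠ 0`, `φ ≠ 0`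
gives `1 ≤ |n|^d ≤ |n|^d deg φ = deg 0 = deg (0 • φ) = 0`. (Mumford §19, Thm. 3: `End(X)` is
torsion-free.) [folklore] -/
theorem noZeroSMulDivisors_int_of_norm_hom {d : ℕ} (hd : 0 < d) (deg : H → ℤ)
    (hpos : ∀ φ : H, φ ≠ 0 → 1 ≤ deg φ)
    (hhom : ∀ (n : ℤ) (φ : H), deg (n • φ) = |n| ^ d * deg φ) :
    NoZeroSMulDivisors ℤ H := by
  refine ⟨fun {n φ} h => ?_⟩
  by_contra hc
  obtain ⟨hn, hφ⟩ := not_or.1 hc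
  have h0 : deg 0 = 0 := by
    have := hhom 0 φ
    rwa [zero_smul, abs_zero, zero_pow hd.ne', zero_mul] at this
  have h1 := hhom n φ
  rw [h, h0] at h1
  have h2 : 1 ≤ deg φ := hpos φ hφ
  have h3 : 1 ≤ |n| ^ d := one_le_pow₀ (Int.one_le_abs hn)
  nlinarith

/-- **Step I of Mumford's proof of §19 Thm. 3 from a degree bound, as algebra.** Let
`deg : H → ℤ` be `≥ 1` at every non-zero element, homogeneous of degree `d ≥ 1` along every `ℤφ`
(`deg (n φ) = |n|^d deg φ`), and bounded on the integer combinations of every finite family `e` by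
`deg (∑ nᵢ eᵢ) ≤ C_e (∑ |nᵢ|)^d`. Then the saturation `{φ | n φ ∈ M, some n ≠ 0}` of every finitely
generated subgroup `M ≤ H` lies in (indeed is) a finitely generated subgroup: `H` is torsion-free,
`M` is free with a finite basis `b`, and if `m φ = ∑ nᵢ bᵢ` with `φ ≠ 0`, `m ≠ 0`, then
`|m|^d ≤ deg (m φ) ≤ C (∑ |nᵢ|)^d`, so the coordinates `nᵢ / m` cannot all be `< ε` for
`ε = 1 / ((r + 1)(C + 1))`; conclude by `fg_of_le_norm_coords`. In the source `H = End(X)` for a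
simple abelian variety `X`, `deg φ = ord Ker φ`, `d = 2 dim X`.
[cite: Milne1986AbelianVarieties, Lemma 12.7 (proof, statement (*), PDF p. 191)] -/
theorem exists_fg_of_norm_bound {d : ℕ} (hd : 0 < d) (deg : H → ℤ)
    (hpos : ∀ φ : H, φ ≠ 0 → 1 ≤ deg φ)
    (hhom : ∀ (n : ℤ) (φ : H), deg (n • φ) = |n| ^ d * deg φ)
    (hbound : ∀ (r : ℕ) (e : Fin r → H), ∃ C : ℤ, ∀ n : Fin r → ℤ,
      deg (∑ i, n i • e i) ≤ C * (∑ i, |n i|) ^ d)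
    (M : Submodule ℤ H) (hM : M.FG) :
    ∃ S : Submodule ℤ H, S.FG ∧ ∀ φ : H, (∃ n : ℤ, n ≠ 0 ∧ n • φ ∈ M) → φ ∈ S := by
  haveI : NoZeroSMulDivisors ℤ H := noZeroSMulDivisors_int_of_norm_hom hd deg hpos hhom
  haveI : Module.Finite ℤ M := Module.Finite.iff_fg.2 hM
  haveI : Module.Free ℤ M := Module.free_of_finite_type_torsion_free'
  -- a finite basis of `M` and the bound for the family
  set r := Module.finrank ℤ M with hr
  let b : Module.Basis (Fin r) ℤ M := Module.finBasis ℤ M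
  obtain ⟨C₀, hC₀⟩ := hbound r fun i => (b i : H)
  -- enlarge the constant to `C ≥ 1`
  set C : ℤ := max C₀ 1 with hCdef
  have hC1 : 1 ≤ C := le_max_right _ _
  have hC : ∀ n : Fin r → ℤ, deg (∑ i, n i • (b i : H)) ≤ C * (∑ i, |n i|) ^ d := fun n =>
    (hC₀ n).trans (mul_le_mul_of_nonneg_right (le_max_left _ _)
      (pow_nonneg (Finset.sum_nonneg fun i _ => abs_nonneg _) _))
  -- the saturation of `M`
  let S : Submodule ℤ H :=
    { carrier := {φ | ∃ n : ℤ, n ≠ 0 ∧ n • φ ∈ M}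
      add_mem' := by
        rintro f g ⟨n, hn, hf⟩ ⟨m, hm, hg⟩
        refine ⟨m * n, mul_ne_zero hm hn, ?_⟩
        rw [smul_add]
        refine M.add_mem ?_ ?_
        · rw [mul_smul]; exact M.smul_mem m hf
        · rw [mul_comm, mul_smul]; exact M.smul_mem n hg
      zero_mem' := ⟨1, one_ne_zero, by rw [smul_zero]; exact M.zero_mem⟩
      smul_mem' := by
        rintro c f ⟨n, hn, hf⟩
        exact ⟨n, hn, by rw [smul_comm]; exact M.smul_mem c hf⟩ }
  have hSmem : ∀ φ : H, φ ∈ S ↔ ∃ n : ℤ, n ≠ 0 ∧ n • φ ∈ M := fun φ => Iff.rfl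
  refine ⟨S, ?_, fun φ hφ => (hSmem φ).2 hφ⟩
  -- the separation constant
  set ε : ℝ := 1 / (((r : ℝ) + 1) * ((C : ℝ) + 1)) with hεdef
  have hCℝ : (1 : ℝ) ≤ C := by exact_mod_cast hC1
  have hden : 0 < ((r : ℝ) + 1) * ((C : ℝ) + 1) := by positivity
  have hε : 0 < ε := by rw [hεdef]; positivity
  refine fg_of_le_norm_coords M S b (fun φ hφ => (hSmem φ).1 hφ) hε ?_
  intro x _ hx0 m y hm hy
  -- value of `deg` on `y = m x` in coordinates
  have hyrepr : (y : H) = ∑ i, b.repr y i • (b i : H) := by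
    conv_lhs => rw [← b.sum_repr y]
    rw [Submodule.coe_sum]
    simp only [Submodule.coe_smul]
  have hup : deg (y : H) ≤ C * (∑ i, |b.repr y i|) ^ d := by rw [hyrepr]; exact hC _
  have hlow : |m| ^ d ≤ deg (y : H) := by
    rw [← hy, hhom]
    have h1 : 1 ≤ deg x := hpos x hx0
    have h2 : 0 ≤ |m| ^ d := pow_nonneg (abs_nonneg _) _
    nlinarith
  -- if all coordinates were `< ε` in absolute value
  by_contra hlt
  rw [not_le] at hlt
  have hcoord : ∀ i, |(b.repr y i : ℝ) / m| < ε := fun i => by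
    have := (pi_norm_lt_iff hε).1 hlt i
    rwa [Real.norm_eq_abs] at this
  have hmℝ : (0 : ℝ) < |(m : ℝ)| := abs_pos.2 (Int.cast_ne_zero.2 hm)
  have hcoord' : ∀ i, |(b.repr y i : ℝ)| < ε * |(m : ℝ)| := fun i => by
    have := hcoord i
    rwa [abs_div, div_lt_iff₀ hmℝ] at this
  have hsum : (∑ i, |(b.repr y i : ℝ)|) ≤ r * (ε * |(m : ℝ)|) := by
    calc (∑ i, |(b.repr y i : ℝ)|) ≤ ∑ _i : Fin r, ε * |(m : ℝ)| :=
          Finset.sum_le_sum fun i _ => (hcoord' i).le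
      _ = r * (ε * |(m : ℝ)|) := by
          rw [Finset.sum_const, Finset.card_univ, Fintype.card_fin, nsmul_eq_mul]
  -- combine: `|m|^d ≤ C (∑ |nᵢ|)^d ≤ C (r ε |m|)^d`
  have hchain : (|(m : ℝ)|) ^ d ≤ (C : ℝ) * ((r : ℝ) * (ε * |(m : ℝ)|)) ^ d := by
    have h1 : ((|m| ^ d : ℤ) : ℝ) ≤ ((C * (∑ i, |b.repr y i|) ^ d : ℤ) : ℝ) := by
      exact_mod_cast hlow.trans hup
    push_cast at h1
    refine h1.trans ?_
    have hC0 : (0 : ℝ) ≤ C := by linarith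
    exact mul_le_mul_of_nonneg_left
      (pow_le_pow_left₀ (Finset.sum_nonneg fun i _ => abs_nonneg _) hsum _) hC0
  -- but `C (r ε)^d < 1`
  have hrε : (r : ℝ) * ε < 1 / ((C : ℝ) + 1) := by
    rw [hεdef, lt_div_iff₀ (by linarith : (0 : ℝ) < (C : ℝ) + 1)]
    have : (r : ℝ) * (1 / (((r : ℝ) + 1) * ((C : ℝ) + 1))) * ((C : ℝ) + 1) =
        (r : ℝ) / ((r : ℝ) + 1) := by
      field_simp
    rw [this, div_lt_one (by positivity)]
    exact lt_add_one _
  have hrε0 : 0 ≤ (r : ℝ) * ε := by positivity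
  have hrε1 : (r : ℝ) * ε ≤ 1 :=
    hrε.le.trans ((div_le_one (by linarith)).2 (by linarith))
  have hpow : ((r : ℝ) * ε) ^ d ≤ (r : ℝ) * ε := pow_le_of_le_one hrε0 hrε1 hd.ne'
  have hmd : (0 : ℝ) < |(m : ℝ)| ^ d := pow_pos hmℝ _
  have key : (|(m : ℝ)|) ^ d ≤ (C : ℝ) * ((r : ℝ) * ε) ^ d * |(m : ℝ)| ^ d := by
    have := hchain
    rw [show (r : ℝ) * (ε * |(m : ℝ)|) = ((r : ℝ) * ε) * |(m : ℝ)| by ring, mul_pow,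
      ← mul_assoc] at this
    exact this
  have key2 : (1 : ℝ) ≤ (C : ℝ) * ((r : ℝ) * ε) ^ d := by
    by_contra hlt'
    rw [not_le] at hlt'
    have : (C : ℝ) * ((r : ℝ) * ε) ^ d * |(m : ℝ)| ^ d < 1 * |(m : ℝ)| ^ d :=
      mul_lt_mul_of_pos_right hlt' hmd
    rw [one_mul] at this
    exact absurd key (not_le.2 this)
  have key3 : (C : ℝ) * ((r : ℝ) * ε) ^ d < 1 := by
    calc (C : ℝ) * ((r : ℝ) * ε) ^ d ≤ (C : ℝ) * ((r : ℝ) * ε) :=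
          mul_le_mul_of_nonneg_left hpow (by linarith)
      _ < (C : ℝ) * (1 / ((C : ℝ) + 1)) := mul_lt_mul_of_pos_left hrε (by linarith)
      _ < 1 := by
          rw [mul_one_div, div_lt_one (by linarith)]
          exact lt_add_one _
  linarith

end Norm

/-! ### `End(X)` when every non-zero endomorphism is an isogeny, from the degree bound -/

section AbelianVariety
open Literature.AlgebraicGeometry.Motives (AbelianVariety)
open Literature.AlgebraicGeometry.Motives.AbelianVariety

variable {K : Type u} [Field K]

open Classical in
/-- **Homogeneity of the degree along `ℤφ`: `deg (n φ) = |n|^{2g} deg φ`** for an abelian variety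
`X` of dimension `g` all of whose non-zero endomorphisms are isogenies, granted the named facts
`isIsogeny_zsmul_id X` (`[n]_X` is an isogeny, Mumford §6 App. 2) and `kerRank_zsmul_id X`
(`deg [n]_X = n^{2g}`, Mumford §6 App. 3, Prop. p. 64): `n φ = [n]_X ≫ φ` and degrees of isogenies
multiply (`IsIsogeny.kerRank_comp`; Mumford §19, proof of Thm. 2: "`deg nφ = deg n_X deg φ
= n^{2g} deg φ`"). Here `deg φ = ord Ker φ` for isogenies and `0` otherwise, `dim X > 0`.
[cite: MumfordAV1970, §19 Thm. 2 (proof) and §6 App. 3] -/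
theorem _root_.Literature.AlgebraicGeometry.Motives.AbelianVariety.kerRank_zsmul_eq_of_isIsogeny
    (X : AbelianVariety K) (hiso : ∀ φ : X ⟶ X, φ ≠ 0 → IsIsogeny φ) (hX : 0 < X.dim)
    (h₀ : isIsogeny_zsmul_id X) (hn : kerRank_zsmul_id X) (n : ℤ) (φ : X ⟶ X) :
    (if IsIsogeny (n • φ) then (Hom.kerRank (n • φ) : ℤ) else 0) =
      |n| ^ (2 * X.dim) * (if IsIsogeny φ then (Hom.kerRank φ : ℤ) else 0) := by
  have h2 : 2 * X.dim ≠ 0 := by omega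
  by_cases hn0 : n = 0
  · subst hn0
    rw [zero_smul, if_neg (not_isIsogeny_zero_of_dim_pos hX), abs_zero, zero_pow h2, zero_mul]
  by_cases hφ : φ = 0
  · subst hφ
    rw [smul_zero, if_neg (not_isIsogeny_zero_of_dim_pos hX), mul_zero]
  have hφi : IsIsogeny φ := hiso φ hφ
  have hni : IsIsogeny (n • 𝟙 X) := h₀ n hn0
  have hcomp : n • φ = (n • 𝟙 X) ≫ φ := by rw [Preadditive.zsmul_comp, Category.id_comp]
  have hnφ : IsIsogeny (n • φ) := by rw [hcomp]; exact isIsogeny_comp hni hφi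
  rw [if_pos hnφ, if_pos hφi, hcomp, hni.kerRank_comp hφi, hn n hn0]
  push_cast
  rfl

open Classical in
/-- **Step I of Mumford's proof of §19 Thm. 3 for `End(X)` from a degree bound.** Suppose every
non-zero endomorphism of `X` is an isogeny (`X` simple; Mumford §19, Cor. 2 of Thm. 1), `dim X > 0`,
`[n]_X` is an isogeny of degree `n^{2 dim X}` (the named facts `isIsogeny_zsmul_id X`,
`kerRank_zsmul_id X`; Mumford §6 App. 2–3), and the degree is bounded on the integer combinations
of every finite family `e` of endomorphisms by `C_e (∑ |nᵢ|)^{2 dim X}` (a consequence of the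
quadraticity of `φ ↦ φ^*D`, Mumford §6 Cor. 2; in Mumford's text subsumed by §19 Thm. 2). Then the
saturation `ℚM ∩ End(X)` of every finitely generated `M ≤ End(X)` lies in a finitely generated
subgroup (Milne 1986, Lemma 12.7, `(*)`; Mumford §19, proof of Thm. 3, first step), by
`exists_fg_of_norm_bound`. [cite: Milne1986AbelianVarieties, Lemma 12.7 (proof, statement (*), PDF p. 191)] -/
theorem _root_.Literature.AlgebraicGeometry.Motives.AbelianVariety.exists_fg_saturation_end_of_degBound
    (X : AbelianVariety K) (hiso : ∀ φ : X ⟶ X, φ ≠ 0 → IsIsogeny φ) (hX : 0 < X.dim)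
    (h₀ : isIsogeny_zsmul_id X) (hn : kerRank_zsmul_id X)
    (hbound : ∀ (r : ℕ) (e : Fin r → (X ⟶ X)), ∃ C : ℤ, ∀ n : Fin r → ℤ,
      (if IsIsogeny (∑ i, n i • e i) then (Hom.kerRank (∑ i, n i • e i) : ℤ) else 0) ≤
        C * (∑ i, |n i|) ^ (2 * X.dim))
    (M : Submodule ℤ (X ⟶ X)) (hM : M.FG) :
    ∃ S : Submodule ℤ (X ⟶ X), S.FG ∧ ∀ φ : X ⟶ X, (∃ n : ℤ, n ≠ 0 ∧ n • φ ∈ M) → φ ∈ S := by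
  refine exists_fg_of_norm_bound (d := 2 * X.dim) (by omega)
    (fun φ => if IsIsogeny φ then (Hom.kerRank φ : ℤ) else 0) (fun φ hφ => ?_)
    (kerRank_zsmul_eq_of_isIsogeny X hiso hX h₀ hn) hbound M hM
  rw [if_pos (hiso φ hφ)]
  haveI := (hiso φ hφ).2
  exact_mod_cast Hom.kerRank_pos φ

/-! ### The reduction to `End(X)`, `X` simple, with Step I there as an abstract hypothesis -/

variable {X Y : AbelianVariety K}

/-- **Step I of Mumford's proof of §19 Thm. 3 for all `Hom(X, Y)`, from Step I for the
endomorphism rings of simple abelian varieties of positive dimension** (hypothesis `hI`) — the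
induction on `dim X + dim Y` of `exists_fg_saturation_hom_of_poincare`, with the same remaining
hypotheses: torsion-freeness of all `Hom(X, Y)` (`htf`; Mumford §19, Thm. 3, first step), "a
non-zero homomorphism between simple abelian varieties is an isogeny" (`hsimple`; Mumford §19,
Cor. 2 of Thm. 1) and Poincaré's complete reducibility theorem as the two-sided splitting of a
non-simple `X` (`hP`; Mumford §19, Thm. 1 with Cor. 1 and the Remark p. 169). If `X`, `Y` are
simple, either `Hom(X, Y) = 0` or `h ↦ h ≫ g'` (`g'` a quasi-inverse of a non-zero, hence
isogeny, `g : X → Y`) embeds `Hom(X, Y)` into `End(X)`; otherwise split `X` or `Y`.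
[cite: MumfordAV1970, §19 Thm. 3 (proof, reduction to the simple case)] -/
theorem _root_.Literature.AlgebraicGeometry.Motives.AbelianVariety.exists_fg_saturation_hom_of_poincare_of_stepI
    (htf : ∀ (X Y : AbelianVariety K) (n : ℤ) (f : X ⟶ Y), n ≠ 0 → n • f = 0 → f = 0)
    (hsimple : ∀ (X Y : AbelianVariety K), IsSimple X → IsSimple Y →
      ∀ f : X ⟶ Y, f ≠ 0 → IsIsogeny f)
    (hI : ∀ X : AbelianVariety K, IsSimple X → 0 < X.dim →
      ∀ M : Submodule ℤ (X ⟶ X), M.FG →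
        ∃ S : Submodule ℤ (X ⟶ X), S.FG ∧ ∀ φ : X ⟶ X, (∃ n : ℤ, n ≠ 0 ∧ n • φ ∈ M) → φ ∈ S)
    (hP : ∀ X : AbelianVariety K, ¬ IsSimple X → ∃ X₁ X₂ : AbelianVariety K,
      X₁.dim < X.dim ∧ X₂.dim < X.dim ∧ (∃ σ : X₁ ⊞ X₂ ⟶ X, IsIsogeny σ) ∧
        ∃ τ : X ⟶ X₁ ⊞ X₂, IsIsogeny τ)
    (X Y : AbelianVariety K) (M : Submodule ℤ (X ⟶ Y)) (hM : M.FG) :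
    ∃ S : Submodule ℤ (X ⟶ Y), S.FG ∧ ∀ f : X ⟶ Y, (∃ n : ℤ, n ≠ 0 ∧ n • f ∈ M) → f ∈ S := by
  -- induction on `dim X + dim Y`
  suffices key : ∀ (N : ℕ) (X Y : AbelianVariety K), X.dim + Y.dim ≤ N →
      ∀ M : Submodule ℤ (X ⟶ Y), M.FG →
        ∃ S : Submodule ℤ (X ⟶ Y), S.FG ∧ ∀ f : X ⟶ Y, (∃ n : ℤ, n ≠ 0 ∧ n • f ∈ M) → f ∈ S from
    key _ X Y le_rfl M hM
  intro N
  induction N with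
  | zero =>
    intro X Y hXY
    exact exists_fg_saturation_of_forall_eq_zero (hom_eq_zero_of_dim_eq_zero (Or.inl (by omega)))
  | succ N ih =>
    intro X Y hXY
    by_cases hX : IsSimple X
    · by_cases hY : IsSimple Y
      · -- both simple
        by_cases h0 : ∀ f : X ⟶ Y, f = 0
        · exact exists_fg_saturation_of_forall_eq_zero h0
        · simp only [not_forall] at h0
          obtain ⟨g, hg⟩ := h0
          have hgi : IsIsogeny g := hsimple X Y hX hY g hg
          have hXpos : 0 < X.dim := by
            by_contra hle
            exact hg (hom_eq_zero_of_dim_eq_zero (Or.inl (by omega)) g)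
          obtain ⟨g', m, hm, -, hg'g⟩ := IsIsogeny.exists_nsmul_inverse_holds hgi
          -- `h ↦ h ≫ g'` embeds `Hom(X, Y)` into `End X`
          let emb : (X ⟶ Y) →ₗ[ℤ] (X ⟶ X) :=
            { toFun := fun h => h ≫ g'
              map_add' := fun f g => Preadditive.add_comp _ _ _ _ _ _
              map_smul' := fun n f => by rw [Preadditive.zsmul_comp, RingHom.id_apply] }
          have hemb : Function.Injective emb := by
            intro h h' hh
            have hh' : (h ≫ g') ≫ g = (h' ≫ g') ≫ g := congrArg (· ≫ g) hh
            rw [Category.assoc, Category.assoc, hg'g, Preadditive.comp_nsmul, Preadditive.comp_nsmul,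
              Category.comp_id, Category.comp_id] at hh'
            have h3 : (m : ℤ) • (h - h') = 0 := by
              rw [natCast_zsmul, smul_sub, sub_eq_zero]
              exact hh'
            exact sub_eq_zero.1 (htf X Y m (h - h') (by exact_mod_cast hm.ne') h3)
          exact exists_fg_saturation_of_injective emb hemb (hI X hX hXpos)
      · -- `Y` not simple: split the target
        obtain ⟨Y₁, Y₂, hY₁, hY₂, -, τ, hτ⟩ := hP Y hY
        obtain ⟨e, he⟩ := exists_linearMap_hom_biprod_injective X Y₁ Y₂
        let κ : (X ⟶ Y) →ₗ[ℤ] (X ⟶ Y₁ ⊞ Y₂) :=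
          { toFun := fun h => h ≫ τ
            map_add' := fun f g => Preadditive.add_comp _ _ _ _ _ _
            map_smul' := fun n f => by rw [Preadditive.zsmul_comp, RingHom.id_apply] }
        have hκ : Function.Injective κ := IsIsogeny.comp_right_injective (htf X Y) hτ
        refine exists_fg_saturation_of_injective (e.comp κ) (he.comp hκ) ?_
        exact exists_fg_saturation_prod (ih X Y₁ (by omega)) (ih X Y₂ (by omega))
    · -- `X` not simple: split the source
      obtain ⟨X₁, X₂, hX₁, hX₂, ⟨σ, hσ⟩, -⟩ := hP X hX
      obtain ⟨e, he⟩ := exists_linearMap_biprod_hom_injective X₁ X₂ Y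
      let κ : (X ⟶ Y) →ₗ[ℤ] (X₁ ⊞ X₂ ⟶ Y) :=
        { toFun := fun h => σ ≫ h
          map_add' := fun f g => Preadditive.comp_add _ _ _ _ _ _
          map_smul' := fun n f => by rw [Preadditive.comp_zsmul, RingHom.id_apply] }
      have hκ : Function.Injective κ := hσ.comp_left_injective
      refine exists_fg_saturation_of_injective (e.comp κ) (he.comp hκ) ?_
      exact exists_fg_saturation_prod (ih X₁ Y (by omega)) (ih X₂ Y (by omega))

/-- **Mumford, *Abelian Varieties*, §19, Theorem 3 (`Hom(A, B)` is finitely generated) from Step I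
for simple endomorphism rings.** The named fact `module_finite_hom A B` follows from:
torsion-freeness of all `Hom(X, Y)`, "non-zero homomorphisms between simple abelian varieties are
isogenies" (§19 Cor. 2 of Thm. 1), Step I for `End(X)`, `X` simple of positive dimension (in the
text: from §19 Thm. 2), Poincaré's complete reducibility theorem (§19 Thm. 1 and Cor. 1) and the
torsion counts `#A[n](K̄) = n^{2 dim A}`, `#B[n](K̄) = n^{2 dim B}` (§6, Prop. p. 64; the named
facts `natCard_torsionPoints_of_isAlgClosed`). Steps II–III are
`module_finite_hom_of_exists_fg_of_natCard_torsionPoints` (`AVIsogenyTateHomStepIIProofs`).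
[cite: MumfordAV1970, §19 Thm. 3] -/
theorem _root_.Literature.AlgebraicGeometry.Motives.AbelianVariety.module_finite_hom_of_poincare_of_stepI
    (htf : ∀ (X Y : AbelianVariety K) (n : ℤ) (f : X ⟶ Y), n ≠ 0 → n • f = 0 → f = 0)
    (hsimple : ∀ (X Y : AbelianVariety K), IsSimple X → IsSimple Y →
      ∀ f : X ⟶ Y, f ≠ 0 → IsIsogeny f)
    (hI : ∀ X : AbelianVariety K, IsSimple X → 0 < X.dim →
      ∀ M : Submodule ℤ (X ⟶ X), M.FG →
        ∃ S : Submodule ℤ (X ⟶ X), S.FG ∧ ∀ φ : X ⟶ X, (∃ n : ℤ, n ≠ 0 ∧ n • φ ∈ M) → φ ∈ S)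
    (hP : ∀ X : AbelianVariety K, ¬ IsSimple X → ∃ X₁ X₂ : AbelianVariety K,
      X₁.dim < X.dim ∧ X₂.dim < X.dim ∧ (∃ σ : X₁ ⊞ X₂ ⟶ X, IsIsogeny σ) ∧
        ∃ τ : X ⟶ X₁ ⊞ X₂, IsIsogeny τ)
    (A B : AbelianVariety K) (hA : A.natCard_torsionPoints_of_isAlgClosed (AlgebraicClosure K))
    (hB : B.natCard_torsionPoints_of_isAlgClosed (AlgebraicClosure K)) :
    module_finite_hom A B :=
  module_finite_hom_of_exists_fg_of_natCard_torsionPoints A B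
    (exists_fg_saturation_hom_of_poincare_of_stepI htf hsimple hI hP A B) hA hB

open Classical in
/-- **Mumford §19 Theorem 3 from Poincaré reducibility, simplicity, the degree *bound* and the
named facts `isIsogeny_zsmul_id`, `kerRank_zsmul_id`, `natCard_torsionPoints_of_isAlgClosed`**
(the three consequences of the theorem of the cube among the inputs; `isIsogeny_zsmul_id` also
gives the torsion-freeness of `Hom`, `eq_zero_of_zsmul_eq_zero_of_isIsogeny`). Step I for
`End(X)`, `X` simple of positive dimension, is `exists_fg_saturation_end_of_degBound`.
[cite: MumfordAV1970, §19 Thm. 3] -/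
theorem _root_.Literature.AlgebraicGeometry.Motives.AbelianVariety.module_finite_hom_of_poincare_of_degBound
    (h₀ : ∀ X : AbelianVariety K, isIsogeny_zsmul_id X)
    (hn : ∀ X : AbelianVariety K, IsSimple X → 0 < X.dim → kerRank_zsmul_id X)
    (hsimple : ∀ (X Y : AbelianVariety K), IsSimple X → IsSimple Y →
      ∀ f : X ⟶ Y, f ≠ 0 → IsIsogeny f)
    (hbound : ∀ X : AbelianVariety K, IsSimple X → 0 < X.dim →
      ∀ (r : ℕ) (e : Fin r → (X ⟶ X)), ∃ C : ℤ, ∀ n : Fin r → ℤ,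
        (if IsIsogeny (∑ i, n i • e i) then (Hom.kerRank (∑ i, n i • e i) : ℤ) else 0) ≤
          C * (∑ i, |n i|) ^ (2 * X.dim))
    (hP : ∀ X : AbelianVariety K, ¬ IsSimple X → ∃ X₁ X₂ : AbelianVariety K,
      X₁.dim < X.dim ∧ X₂.dim < X.dim ∧ (∃ σ : X₁ ⊞ X₂ ⟶ X, IsIsogeny σ) ∧
        ∃ τ : X ⟶ X₁ ⊞ X₂, IsIsogeny τ)
    (A B : AbelianVariety K) (hA : A.natCard_torsionPoints_of_isAlgClosed (AlgebraicClosure K))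
    (hB : B.natCard_torsionPoints_of_isAlgClosed (AlgebraicClosure K)) :
    module_finite_hom A B :=
  module_finite_hom_of_poincare_of_stepI
    (fun X _ _ _ hn0 h => eq_zero_of_zsmul_eq_zero_of_isIsogeny (h₀ X _ hn0) h) hsimple
    (fun X hX hXpos => exists_fg_saturation_end_of_degBound X (hsimple X X hX hX) hXpos (h₀ X)
      (hn X hX hXpos) (hbound X hX hXpos))
    hP A B hA hB

open Classical in
/-- **Mumford §19 Theorem 3 from Mumford's statements, with the degree theorem replaced by the
degree bound**: `module_finite_hom A B` follows from Poincaré's complete reducibility theorem in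
the form of §19 Thm. 1 (a complement `Z` with `Y ⊞ Z → X` an isogeny), "non-zero homomorphisms
between simple abelian varieties are isogenies" (§19 Cor. 2 of Thm. 1), the bound
`deg (∑ nᵢ eᵢ) ≤ C_e (∑ |nᵢ|)^{2 dim X}` for simple `X` of positive dimension, and the named facts
`isIsogeny_zsmul_id` (§6 App. 2; giving also the symmetry of isogeny,
`IsIsogenous.symm_of_isIsogeny_zsmul_id`), `kerRank_zsmul_id` (§6 App. 3) for simple `X`, and the
torsion counts of `A`, `B` (§6 Prop. p. 64, `natCard_torsionPoints_of_isAlgClosed`).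
[cite: MumfordAV1970, §19 Thm. 3] -/
theorem _root_.Literature.AlgebraicGeometry.Motives.AbelianVariety.module_finite_hom_of_mumford19_of_degBound
    (h₀ : ∀ X : AbelianVariety K, isIsogeny_zsmul_id X)
    (hn : ∀ X : AbelianVariety K, IsSimple X → 0 < X.dim → kerRank_zsmul_id X)
    (hP1 : ∀ (X Y : AbelianVariety K) (i : Y ⟶ X), IsClosedImmersion (Hom.toSchemeHom i) →
      0 < Y.dim → Y.dim < X.dim →
      ∃ (Z : AbelianVariety K) (j : Z ⟶ X), IsClosedImmersion (Hom.toSchemeHom j) ∧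
        IsIsogeny (biprod.desc i j))
    (hsimple : ∀ (X Y : AbelianVariety K), IsSimple X → IsSimple Y →
      ∀ f : X ⟶ Y, f ≠ 0 → IsIsogeny f)
    (hbound : ∀ X : AbelianVariety K, IsSimple X → 0 < X.dim →
      ∀ (r : ℕ) (e : Fin r → (X ⟶ X)), ∃ C : ℤ, ∀ n : Fin r → ℤ,
        (if IsIsogeny (∑ i, n i • e i) then (Hom.kerRank (∑ i, n i • e i) : ℤ) else 0) ≤
          C * (∑ i, |n i|) ^ (2 * X.dim))
    (A B : AbelianVariety K) (hA : A.natCard_torsionPoints_of_isAlgClosed (AlgebraicClosure K))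
    (hB : B.natCard_torsionPoints_of_isAlgClosed (AlgebraicClosure K)) :
    module_finite_hom A B :=
  module_finite_hom_of_poincare_of_degBound h₀ hn hsimple hbound
    (exists_isogeny_biprod_of_poincare
      (fun X Y => IsIsogenous.symm_of_isIsogeny_zsmul_id (h₀ X) (h₀ Y)) hP1) A B hA hB

end AbelianVariety

end Literature.NumberTheory.DiophantineGeometry
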